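/-
Copyright (c) 2026. All rights reserved.
Released under Apache 2.0 license as described in the file LICENSE.
Authors: HodgeCM publication cell (pub-hodgecm), GR lane, seat GR-2 (`pub-hodgecm-own-hyp34`).
-/
import Literature.NumberTheory.Weil1964.ArchMetaplecticLeviSection
import Literature.NumberTheory.Weil1964.ArchMetaplecticQuotientCharacter
import Literature.NumberTheory.Weil1964.ArchMetaplecticGaussMultiplier
import HarnessLib

/-!
# An element of `Mp^𝓢(W)` fixing the vacuum commutes with every element over its centraliser; sign Levi elements

Topic `NumberTheory/Weil1964`; namespace `Literature.NumberTheory.Weil1964.MpS`.  KERNEL ONLY: theorems only; no definition,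
no `def … : Prop` record, no axiom, no proof hole.

Let `R ∈ Mp^𝓢(W)` (`MpS σ`, Folland's group of Heisenberg-covariant topological automorphisms of `𝓢(ℝ^σ)` with unitary
`L²`-lifts over `Sp(W)`, `W = ℝ^σ × ℝ^σ`) FIX THE VACUUM VECTOR `h₀` (`R h₀ = h₀`), and let `y ∈ Mp^𝓢(W)` lie over an
element of `Sp(W)` commuting with `proj R`.  Then **`R y = y R`** (`mul_eq_mul_of_apply_hermitePi_zero`).  Proof: by
Schur (`exists_eq_unitScalar_mul_of_proj_eq`) `R y R⁻¹ = c · y` with `|c| = 1`; taking vacuum coefficients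
(`C(x) = ⟪h₀, x h₀⟫`, `MpS.vac`; `R⁻¹ h₀ = h₀` and `R` is unitary, `inner_apply_eq_inner_inv_apply`) gives
`C(R y R⁻¹) = C(y)`, while `C(c · y) = c C(y)` and `C(y) ≠ 0` for every `y` (`quot_ne_zero`); so `c = 1`.

Application (§2): the SIGN LEVI ELEMENTS `leviGL a`, `a = diag(ε)`, `ε_i = ±1` (`(leviGL a f)(x) = f(ε x)`,
`|det a|^{-1/2} = 1`), fix `h₀ = c_σ e^{−π|x|²}` (`leviS_hermitePi_zero_of_sq`, `leviGL_apply_hermitePi_zero_of_eq_diagonal_sign`),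
hence **commute with every element of `Mp^𝓢(W)` over the centraliser of `m(diag ε)`**
(`leviGL_mul_eq_mul_of_eq_diagonal_sign`, `conj_leviGL_eq_of_eq_diagonal_sign`).  In particular a lift of `−1_W` is
central in `Mp^𝓢(W)`.  (Use: the origin value of the archimedean Weil section of a unitary group at the rational sign
elements of its Siegel parabolic, place type (ii) of [GelbartRogawski1991, Prop. 3.1.1].)

## References
* [Folland1989] G. B. Folland, *Harmonic Analysis in Phase Space*, Princeton UP 1989, §4.2 (4.23)–(4.24), (4.36), Thm. (4.37).
* [LionVergne1980] G. Lion, M. Vergne, *The Weil representation, Maslov index and Theta series*, Birkhäuser 1980, §1.6.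
-/

set_option autoImplicit false

noncomputable section

open MeasureTheory Complex Matrix SchwartzMap
open scoped InnerProductSpace ComplexConjugate Real

namespace Literature.NumberTheory.Weil1964

open Literature.Analysis.SegalBargmann Literature.RepresentationTheory.HeisenbergGroup
open Literature.RepresentationTheory.HeisenbergGroup.SymplecticMatrix

namespace MpS

variable {σ : Type*} [Fintype σ] [DecidableEq σ]

/-! ## §1 Vacuum-fixing elements commute with the lifts of their centraliser -/

/-- if `R h₀ = h₀` then `R⁻¹ h₀ = h₀`. [cite: Folland1989, §4.2 (4.23)] -/
theorem inv_apply_hermitePi_zero {R : MpS σ} (hR : R.1.2 (hermitePi (0 : σ →₀ ℕ)) = hermitePi 0) :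
    (R⁻¹).1.2 (hermitePi (0 : σ →₀ ℕ)) = hermitePi 0 := by
  have h := congrArg ((R⁻¹).1.2) hR
  rw [← mul_apply, inv_mul_cancel] at h
  exact h.symm

/-- the vacuum coefficient is invariant under conjugation by a vacuum-fixing element: `C(R y R⁻¹) = C(y)`.
[cite: Folland1989, §4.2 (4.36)] -/
theorem vac_conj_of_apply_hermitePi_zero {R : MpS σ} (hR : R.1.2 (hermitePi (0 : σ →₀ ℕ)) = hermitePi 0) (y : MpS σ) :
    vac (R * y * R⁻¹) = vac y := by
  rw [vac_apply, vac_apply, mul_apply, mul_apply, inv_apply_hermitePi_zero hR, ← toL2_hermitePi_zero,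
    inner_apply_eq_inner_inv_apply R, inv_apply_hermitePi_zero hR]

omit [DecidableEq σ] in
/-- `(1 · 1) y = y`. [cite: Folland1989, §4.2 (4.23)] -/
theorem unitScalar_one_mul (h : ‖(1 : ℂ)‖ = 1) (y : MpS σ) : unitScalar 1 h * y = y :=
  ext' (by rw [map_mul, proj_unitScalar, one_mul]) fun f => by rw [mul_apply, unitScalar_apply, one_smul]

/-- **A VACUUM-FIXING ELEMENT COMMUTES WITH EVERY LIFT OF ITS CENTRALISER.**  If `R h₀ = h₀` and `proj y` commutes with
`proj R` in `Sp(W)`, then `R y = y R` in `Mp^𝓢(W)`. [cite: Folland1989, §4.2 (4.23), (4.36); LionVergne1980, §1.6] -/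
theorem mul_eq_mul_of_apply_hermitePi_zero {R y : MpS σ} (hR : R.1.2 (hermitePi (0 : σ →₀ ℕ)) = hermitePi 0)
    (hc : proj R * proj y = proj y * proj R) : R * y = y * R := by
  have hproj : proj y = proj (R * y * R⁻¹) := by
    rw [map_mul, map_mul, map_inv, hc, mul_inv_cancel_right]
  obtain ⟨c, hc1, hcy⟩ := exists_eq_unitScalar_mul_of_proj_eq hproj
  have hv : c * vac y = vac y := by
    rw [← vac_unitScalar_mul c hc1, ← hcy]
    exact vac_conj_of_apply_hermitePi_zero hR y
  have hc2 : c = 1 := mul_eq_right₀ (vac_ne_zero y) |>.1 hv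
  have hconj : R * y * R⁻¹ = y := by
    rw [hcy]
    subst hc2
    exact unitScalar_one_mul hc1 y
  calc R * y = R * y * R⁻¹ * R := by group
    _ = y * R := by rw [hconj]

/-! ## §2 Sign Levi elements fix the vacuum -/

/-- a Levi operator with `|det a| = 1` preserving `Σ x_k²` fixes the vacuum `h₀ = c_σ e^{−π Σ x_k²}`.
[cite: Folland1989, §4.2 (4.24), §1.7] -/
theorem leviS_hermitePi_zero_of_sq (a : (σ → ℝ) ≃ₗ[ℝ] (σ → ℝ)) (hdet : |LinearMap.det (a : (σ → ℝ) →ₗ[ℝ] (σ → ℝ))| = 1)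
    (hiso : ∀ x : σ → ℝ, ∑ k, ((a.symm x k : ℝ) : ℂ) ^ 2 = ∑ k, ((x k : ℝ) : ℂ) ^ 2) :
    leviS a (hermitePi (0 : σ →₀ ℕ)) = hermitePi 0 := by
  ext x
  rw [leviS_apply, hermitePi_apply, hermitePi_apply, herm_zero, hermiteFun, hermiteFun, gauss, gauss, hiso x, leviFactor,
    hdet, Real.one_rpow, Complex.ofReal_one, one_mul, Literature.Analysis.SegalBargmann.vac, MvPolynomial.eval_C,
    MvPolynomial.eval_C]

variable (ε : σ → ℝ) (hε : ∀ i, ε i = 1 ∨ ε i = -1) (a : GL σ ℝ) (ha : (a : Matrix σ σ ℝ) = Matrix.diagonal ε)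

omit [Fintype σ] [DecidableEq σ] in
include hε in
/-- `ε_i² = 1`. [cite: Folland1989, §4.2 (4.24)] -/
theorem sign_mul_self (i : σ) : ε i * ε i = 1 := by
  rcases hε i with h | h <;> rw [h] <;> norm_num

include hε in
/-- `diag(ε)² = 1`. [cite: Folland1989, §4.2 (4.24)] -/
theorem diagonal_sign_mul_self : Matrix.diagonal ε * Matrix.diagonal ε = 1 := by
  rw [Matrix.diagonal_mul_diagonal, ← Matrix.diagonal_one]
  exact congrArg Matrix.diagonal (funext fun i => sign_mul_self ε hε i)

include hε ha in
/-- a sign Levi element is an involution: `(a⁻¹ : M_σ(ℝ)) = diag(ε)` for `a = diag(ε)`. [cite: Folland1989, §4.2 (4.24)] -/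
theorem coe_inv_of_eq_diagonal_sign : ((a⁻¹ : GL σ ℝ) : Matrix σ σ ℝ) = Matrix.diagonal ε := by
  have h1 : ((a⁻¹ : GL σ ℝ) : Matrix σ σ ℝ) * (a : Matrix σ σ ℝ) = 1 := by
    rw [← Units.val_mul, inv_mul_cancel, Units.val_one]
  calc ((a⁻¹ : GL σ ℝ) : Matrix σ σ ℝ) = ((a⁻¹ : GL σ ℝ) : Matrix σ σ ℝ) * (Matrix.diagonal ε * Matrix.diagonal ε) := by
        rw [diagonal_sign_mul_self ε hε, mul_one]
    _ = Matrix.diagonal ε := by rw [← mul_assoc, ← ha, h1, one_mul]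

include hε in
/-- `|det diag(ε)| = 1`. [cite: Folland1989, §4.2 (4.24)] -/
theorem abs_det_diagonal_sign : |(Matrix.diagonal ε).det| = 1 := by
  rw [Matrix.det_diagonal, Finset.abs_prod]
  exact Finset.prod_eq_one fun i _ => by rcases hε i with h | h <;> rw [h] <;> norm_num

include hε ha in
/-- **`leviGL a h₀ = h₀` for `a = diag(ε)`**: the sign Levi operator `f ↦ f(ε x)` fixes the vacuum. [cite: Folland1989, §4.2 (4.24), §1.7] -/
theorem leviGL_apply_hermitePi_zero_of_eq_diagonal_sign :
    (leviGL a).1.2 (hermitePi (0 : σ →₀ ℕ)) = hermitePi 0 := by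
  rw [leviGL_apply_snd]
  refine leviS_hermitePi_zero_of_sq _ ?_ fun x => ?_
  · rw [show ((glEquiv a : (σ → ℝ) ≃ₗ[ℝ] (σ → ℝ)) : (σ → ℝ) →ₗ[ℝ] (σ → ℝ)) = Matrix.toLin' (Matrix.diagonal ε) from
        LinearMap.ext fun x => by rw [Matrix.toLin'_apply, ← ha]; exact glEquiv_apply _ x,
      LinearMap.det_toLin']
    exact abs_det_diagonal_sign ε hε
  · refine Finset.sum_congr rfl fun k _ => ?_
    rw [glEquiv_symm_apply, coe_inv_of_eq_diagonal_sign ε hε a ha, Matrix.mulVec_diagonal, Complex.ofReal_mul, mul_pow,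
      ← Complex.ofReal_pow (ε k), sq, sign_mul_self ε hε k, Complex.ofReal_one, one_mul]

include ha hε in
/-- `proj (leviGL a)` on vectors, `a = diag(ε)`: `(x, y) ↦ (ε x, ε y)`. [cite: Folland1989, §4.2 (4.24)] -/
theorem coe_proj_leviGL_apply_of_eq_diagonal_sign (p : (σ → ℝ) × (σ → ℝ)) :
    ((proj (leviGL a) : symplecticGroup (polar (dotPairing σ))) : ((σ → ℝ) × (σ → ℝ)) ≃ₗ[ℝ] ((σ → ℝ) × (σ → ℝ))) p =
      (Matrix.diagonal ε *ᵥ p.1, Matrix.diagonal ε *ᵥ p.2) := by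
  rw [coe_proj_leviGL_apply, coe_inv_of_eq_diagonal_sign ε hε a ha, ha, Matrix.diagonal_transpose]

include ha hε in
/-- **SIGN LEVI ELEMENTS COMMUTE WITH EVERY LIFT OF THEIR CENTRALISER**: for `a = diag(ε)`, if `proj y` commutes with
`m(a)` then `leviGL a · y = y · leviGL a` in `Mp^𝓢(W)`. [cite: Folland1989, §4.2 (4.23)–(4.24); LionVergne1980, §1.6] -/
theorem leviGL_mul_eq_mul_of_eq_diagonal_sign (y : MpS σ) (hc : proj (leviGL a) * proj y = proj y * proj (leviGL a)) :
    leviGL a * y = y * leviGL a :=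
  mul_eq_mul_of_apply_hermitePi_zero (leviGL_apply_hermitePi_zero_of_eq_diagonal_sign ε hε a ha) hc

include ha hε in
/-- the same as a conjugation identity: `y · leviGL a · y⁻¹ = leviGL a` (`a = diag(ε)`). [cite: Folland1989, §4.2 (4.23)–(4.24)] -/
theorem conj_leviGL_eq_of_eq_diagonal_sign (y : MpS σ) (hc : proj (leviGL a) * proj y = proj y * proj (leviGL a)) :
    y * leviGL a * y⁻¹ = leviGL a := by
  rw [← leviGL_mul_eq_mul_of_eq_diagonal_sign ε hε a ha y hc, mul_inv_cancel_right]

end MpS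

end Literature.NumberTheory.Weil1964

end
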